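/-
Copyright (c) 2026 the pub-hodgecm-mathlib formalisation cell (harness21).  Prover seat hodgecm-mathlib-K2E3-p05 (g3), Track B «K2-LIT», engine E3, unit U4 «Keys»; PLACE-FREE LAYER
(`hd ↦ hϖ`) of ★ II-2a p855830 and ★ II-2b p856231; 2026-09-04.  KERNEL module: THEOREMS ONLY (no definition, no named fact, no `sorry`, no instance, no notation). -/
import Summits.HodgeConjecture.HodgeConjecture.Theorems.K2E3PSIwahoriBasisPF        -- ★-filed (this seat): II-1-PF (`eq_smul_of_mem_fixedPoints_K0 ∕ _K1` over `hϖ`); brings ★ PS-LEVELS-PF, ★ P1∕P2a PLACE-FREE, FILE C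
import Summits.HodgeConjecture.HodgeConjecture.Theorems.K2E3ParahoricAverageK1       -- ★ II-2b p856231 (g2): the `hd`-free lemmas (cell test §1, `toFun_apply_of_inv_mul_mem_I`, `card_filter_inv_mul_mem_I_eq_one`); brings ★ II-2a's `toFun_apply_of_mem_I`, `card_filter_mem_I_eq_one`, ★ `avgProj`
import HarnessLib

/-!
# K2 ∕ E3 «EllipticInputs», unit U4 «Keys» — Road II′ (TAME RAMIFIED places), PLACE-FREE LAYER II-2-PF «THE TWO PARAHORIC AVERAGES ON THE IWAHORI PLANE»:
# `e_{K₀}(x f₁ + y f_w) = |R|⁻¹(x + (|R|−1)y)·(f₁ + f_w)`, `e_{K₁}(x f₁ + y f_w) = |R′|⁻¹((|R′|−1)x + μy)·(f₁ + μ⁻¹f_w)` at EVERY non-split `v`, over the uniformiser token `hϖ`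
# [Casselman1980 §3; BernsteinZelevinsky1976 §2.3; BruhatTits1972 (4.4.3)–(4.4.4)]

Cell hodgecm-mathlib (D-0151), FLOOR 0, Track B «K2-LIT», engine E3, crux item H413 = stmt-HodgeConjecture-24833; target BY NAME `…U4Keys.sig_K2E3KeysThmTwoContracting` (U4-f),
residue (R1) «ramified places» of MEMO v4 (Road II′).  Author K2E3-p05 (g3).  `--supports stmt-HodgeConjecture-24833 --as helper`; THEOREMS ONLY.  The `hd`-dependent part of
★ II-2a `K2E3ParahoricAverageK0` and ★ II-2b `K2E3ParahoricAverageK1` with the unramified datum `hd` replaced by `hϖ : |ϖ|_w = exp(−1)` (★ II-2 reads `hd` only through `hd.σσ`,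
`hd.vσ`, `hd.vϖ`; place-free ★ `galAdicCompletionMap_galAdicCompletionMap_of_smul_eq`, ★ `valued_galAdicCompletionMap`), proofs VERBATIM, cross-file calls re-pointed to ★ II-1-PF; the
`hd`-free lemmas of ★ II-2a∕II-2b are used by name.  See ★ II-2a∕II-2b for the mathematics.
HONEST LABEL: HC_CM is proved only modulo the 7 printed citations (2 remaining named inputs: hLiu418 = stmt-HodgeConjecture-24832, h413 = stmt-HodgeConjecture-24833) until rung 0 closes; count-neutral.

## References
* [Casselman1980] Compositio Math. 40 (1980), §3.  * [BernsteinZelevinsky1976] §2.3.  * [BruhatTits1972] Publ. Math. IHÉS 41 (1972), (4.4.3)–(4.4.4).  * [Rogawski1990] §4.5 p. 45, §12.2 p. 173.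
-/

set_option autoImplicit false
-- the mandated namespace has the single-problem summit's repeated segment (`HodgeConjecture.HodgeConjecture`)
set_option linter.dupNamespace false

noncomputable section

open NumberField IsDedekindDomain MeasureTheory
open scoped Matrix MatrixGroups NNReal WithZero BigOperators
open Literature.NumberTheory.Automorphic Literature.NumberTheory.Automorphic.UnitaryGroup Literature.NumberTheory.Rogawski1990 Literature.NumberTheory.GaloisRepresentations

namespace Summit.HodgeConjecture.HodgeConjecture.Cruxes.H413.K2E3ParahoricAveragePF

open Summit.HodgeConjecture.HodgeConjecture.Cruxes.H413
open Summit.HodgeConjecture.HodgeConjecture.Cruxes.H413.F0P3cStCharTSStLevelsTransport Summit.HodgeConjecture.HodgeConjecture.Cruxes.H413.F0P3cStCharTSPSLevelsCells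
open Summit.HodgeConjecture.HodgeConjecture.Cruxes.H413.K2E3ParahoricAverageK0 Summit.HodgeConjecture.HodgeConjecture.Cruxes.H413.K2E3ParahoricAverageK1

variable (L : Type) [Field L] [NumberField L] [IsCMField L] (v : HeightOneSpectrum (𝓞 ↥(maximalRealSubfield L)))
  (w : PlacesOver L v) (hw : IsCMField.complexConj L • w.1 = w.1)
  (eA : Gqs L v ≃ₜ* ↥(unitaryGroupOfForm (galAdicCompletionMap (L := L) (IsCMField.complexConj L) hw) ((StdForm.antidiagonal 3).over (w.1.adicCompletion L))))
  (heA : ∀ g : Gqs L v,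
    ((eA g : ↥(unitaryGroupOfForm (galAdicCompletionMap (L := L) (IsCMField.complexConj L) hw) ((StdForm.antidiagonal 3).over (w.1.adicCompletion L)))) : GL (Fin 3) (w.1.adicCompletion L)) =
      ((localNonsplitEquiv (IsCMField.complexConj L) (qsForm L) (IsCMField.complexConj_ne_one L) w hw g :
        ↥(unitaryGroupOfForm (galAdicCompletionMap (L := L) (IsCMField.complexConj L) hw) (placeForm (qsForm L) w.1))) : GL (Fin 3) (w.1.adicCompletion L)))

include heA in
set_option maxHeartbeats 6400000 in
set_option synthInstance.maxHeartbeats 400000 in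
-- instance-path unification between `Gqs L v` and the literal carrier of ★ `cmPrincipalSeries` (class of ★ PS-LEVELS)
/-- **On `K₀ ∖ I` an `I`-fixed vector of an UNRAMIFIED `i_G(χ)` takes the value `f(w̃)`**: by the dichotomy ★ `mem_inf_or_exists_eq_unipotentU_mul_weylLongU_mul` (model, read
through `eA`) such an `r` is `n·w̃·κ` with `n ∈ N ∩ K₀` (so `n ∈ B ∩ K_v`, where the inducing line is trivial, ★ `inducingLine_eq_one_of_mem_integralLevel`) and `κ ∈ I`;
hence `f(r) = σ_χ(n) f(w̃ κ) = f(w̃)`. [cite: BruhatTits1972, (4.4.4)] [cite: Casselman1980, §3] -/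
theorem toFun_apply_of_not_mem_I {ϖ : w.1.adicCompletion L}
    (hϖ : Valued.v ϖ = WithZero.exp (-1 : ℤ))
    (g₁ : GL (Fin 3) (w.1.adicCompletion L)) (hg₁ : (g₁ : Matrix (Fin 3) (Fin 3) (w.1.adicCompletion L)) = Matrix.diagonal ![(1 : w.1.adicCompletion L), 1, ϖ])
    (K0 K1 I : Subgroup (Gqs L v))
    (hK0 : K0 = ((glInt 3 (w.1.adicCompletion L)).subgroupOf
      (unitaryGroupOfForm (galAdicCompletionMap (L := L) (IsCMField.complexConj L) hw) ((StdForm.antidiagonal 3).over (w.1.adicCompletion L)))).comap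
        eA.toMulEquiv.toMonoidHom)
    (hK1 : K1 = (((glInt 3 (w.1.adicCompletion L)).map (MulAut.conj g₁).toMonoidHom).subgroupOf
      (unitaryGroupOfForm (galAdicCompletionMap (L := L) (IsCMField.complexConj L) hw) ((StdForm.antidiagonal 3).over (w.1.adicCompletion L)))).comap
        eA.toMulEquiv.toMonoidHom)
    (hI : I = K0 ⊓ K1)
    (χ : ↥(torusU (conjLocal L (IsCMField.complexConj L) v) (cmLocalForm L 3 v)) →* ℂˣ)
    (hU : ∀ t : ↥(torusU (conjLocal L (IsCMField.complexConj L) v) (cmLocalForm L 3 v)),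
      (t : ↥(unitaryGroupOfForm (conjLocal L (IsCMField.complexConj L) v) (cmLocalForm L 3 v))) ∈ cmLocalIntegralLevel L 3 (qsForm L) v → χ t = 1) :
    haveI := locallyCompactSpace_cmBorelU L 3 v
    ∀ (f : Representation.SmoothInd (cmBorelTriple L 3 v).P
        (Representation.twist (((Representation.trivial ℂ ↥(torusU (conjLocal L (IsCMField.complexConj L) v) (cmLocalForm L 3 v)) ℂ).twist χ).comp
          (cmBorelTriple L 3 v).proj) (rootDeltaChar (cmBorelTriple L 3 v).P))), f ∈ (cmPrincipalSeries L 3 v χ).fixedPoints I →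
      ∀ r : ↥(unitaryGroupOfForm (conjLocal L (IsCMField.complexConj L) v) (cmLocalForm L 3 v)), r ∈ K0 → r ∉ I →
        f.toFun r = f.toFun (eA.symm (weylLongU (galAdicCompletionMap (L := L) (IsCMField.complexConj L) hw) (rfl : (StdForm.antidiagonal 3).over (w.1.adicCompletion L) = _))) := by
  intro f hf r hrK0 hrI
  have hrK0' : eA r ∈ (glInt 3 (w.1.adicCompletion L)).subgroupOf
      (unitaryGroupOfForm (galAdicCompletionMap (L := L) (IsCMField.complexConj L) hw) ((StdForm.antidiagonal 3).over (w.1.adicCompletion L))) :=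
    (mem_comap_iff L v w hw eA _ r).1 (hK0 ▸ hrK0)
  rcases mem_inf_or_exists_eq_unipotentU_mul_weylLongU_mul (galAdicCompletionMap (L := L) (IsCMField.complexConj L) hw)
      (rfl : (StdForm.antidiagonal 3).over (w.1.adicCompletion L) = _) (galAdicCompletionMap_galAdicCompletionMap_of_smul_eq (IsCMField.complexConj L) w (IsCMField.complexConj_ne_one L) hw) (fun a => valued_galAdicCompletionMap (L := L) (IsCMField.complexConj L) hw a) hϖ g₁ hg₁ hrK0' with hI' | ⟨n, hnN, hnK0, κ, hκ, hrnk⟩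
  · -- `eA r ∈ I_model`, i.e. `r ∈ I`: excluded
    exact absurd (hI.symm ▸ Subgroup.mem_inf.2 ⟨hK0 ▸ (mem_comap_iff L v w hw eA _ r).2 (Subgroup.mem_inf.1 hI').1,
      hK1 ▸ (mem_comap_iff L v w hw eA _ r).2 (Subgroup.mem_inf.1 hI').2⟩) hrI
  · -- `r = ñ · w̃ · κ̃` with `ñ = eA⁻¹ n ∈ B ∩ K₀`, `κ̃ = eA⁻¹ κ ∈ I`
    have hnB : (eA.symm n : ↥(unitaryGroupOfForm (conjLocal L (IsCMField.complexConj L) v) (cmLocalForm L 3 v))) ∈ (cmBorelTriple L 3 v).P := eA_symm_mem_borel L v w hw eA heA (unipotentU_le_borelU _ _ hnN)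
    have hnK : (eA.symm n : ↥(unitaryGroupOfForm (conjLocal L (IsCMField.complexConj L) v) (cmLocalForm L 3 v))) ∈ K0 := hK0 ▸ (symm_mem_comap_iff L v w hw eA _ n).2 hnK0
    have hκI : (eA.symm κ : ↥(unitaryGroupOfForm (conjLocal L (IsCMField.complexConj L) v) (cmLocalForm L 3 v))) ∈ I := by
      rw [hI]
      exact Subgroup.mem_inf.2 ⟨hK0 ▸ (symm_mem_comap_iff L v w hw eA _ κ).2 (Subgroup.mem_inf.1 hκ).1,
        hK1 ▸ (symm_mem_comap_iff L v w hw eA _ κ).2 (Subgroup.mem_inf.1 hκ).2⟩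
    have hr : r = ((⟨eA.symm n, hnB⟩ : ↥(cmBorelTriple L 3 v).P) : ↥(unitaryGroupOfForm (conjLocal L (IsCMField.complexConj L) v) (cmLocalForm L 3 v))) * ((![(1 : ↥(unitaryGroupOfForm (conjLocal L (IsCMField.complexConj L) v) (cmLocalForm L 3 v))), eA.symm (weylLongU (galAdicCompletionMap (L := L) (IsCMField.complexConj L) hw) (rfl : (StdForm.antidiagonal 3).over (w.1.adicCompletion L) = _))] 1) * (show ↥(unitaryGroupOfForm (conjLocal L (IsCMField.complexConj L) v) (cmLocalForm L 3 v)) from eA.symm κ)) := by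
      apply eA.injective
      change eA r = eA (eA.symm n * (eA.symm (weylLongU (galAdicCompletionMap (L := L) (IsCMField.complexConj L) hw)
        (rfl : (StdForm.antidiagonal 3).over (w.1.adicCompletion L) = _)) * eA.symm κ))
      rw [map_mul, map_mul, ContinuousMulEquiv.apply_symm_apply, ContinuousMulEquiv.apply_symm_apply, ContinuousMulEquiv.apply_symm_apply,
        ← mul_assoc]
      exact hrnk
    -- the inducing line is trivial at `ñ ∈ B ∩ K_v`
    have hline := inducingLine_eq_one_of_mem_integralLevel L v χ hU ⟨_, hnB⟩ ((mem_K0_iff_mem_integralLevel L v w hw eA heA K0 hK0 _).1 hnK)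
    -- `f(w̃) = (κ̃·f)(w̃) = f(w̃ κ̃)` and `f(ñ (w̃ κ̃)) = σ(ñ) f(w̃ κ̃) = f(w̃ κ̃)`
    have e2 : (cmPrincipalSeries L 3 v χ (show ↥(unitaryGroupOfForm (conjLocal L (IsCMField.complexConj L) v) (cmLocalForm L 3 v)) from eA.symm κ) f).toFun (![(1 : ↥(unitaryGroupOfForm (conjLocal L (IsCMField.complexConj L) v) (cmLocalForm L 3 v))), eA.symm (weylLongU (galAdicCompletionMap (L := L) (IsCMField.complexConj L) hw) (rfl : (StdForm.antidiagonal 3).over (w.1.adicCompletion L) = _))] 1) = f.toFun ((![(1 : ↥(unitaryGroupOfForm (conjLocal L (IsCMField.complexConj L) v) (cmLocalForm L 3 v))), eA.symm (weylLongU (galAdicCompletionMap (L := L) (IsCMField.complexConj L) hw) (rfl : (StdForm.antidiagonal 3).over (w.1.adicCompletion L) = _))] 1) * (show ↥(unitaryGroupOfForm (conjLocal L (IsCMField.complexConj L) v) (cmLocalForm L 3 v)) from eA.symm κ)) :=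
      Representation.toFun_smoothIndRep_apply (show ↥(unitaryGroupOfForm (conjLocal L (IsCMField.complexConj L) v) (cmLocalForm L 3 v)) from eA.symm κ) f _
    rw [(Representation.mem_fixedPoints _ _ _).1 hf _ hκI] at e2
    rw [hr, Representation.SmoothInd.toFun_subgroup_mul f ⟨_, hnB⟩, hline, Module.End.one_apply, ← e2]
    simp

include heA in
set_option maxHeartbeats 12000000 in
set_option synthInstance.maxHeartbeats 400000 in
-- statement∕proof-heavy: the `SmoothInd` carrier of `cmPrincipalSeries`, averaging and II-1 (class of ★ II-1 §3)
/-- **`e_{K₀}(x f₁ + y f_w) = |R|⁻¹ (x + (|R| − 1) y) · (f₁ + f_w)`** for the Iwahori pair `(f₁, f_w)` of an unramified `i_G(χ)` and any left transversal `R` of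
`K₀ ∕ I` (`|R| = [K₀ : I]`): ★ `avgProj_eq` + §1 (values on `I` and on `K₀ ∖ I`) + §2 + ★ II-1 `K2E3PSIwahoriBasisPF.eq_smul_of_mem_fixedPoints_K0` (`e_{K₀} v ∈ V^{K₀} = ℂ(f₁ + f_w)`).
This is the `K₀`-datum `(a₀ : b₀) = (1 : [K₀:I] − 1)`, `e₀ = f₁ + f_w` of ★ `criterion_of_iwahoriLine`. [cite: Casselman1980, §3] [cite: BernsteinZelevinsky1976, §2.3] -/
theorem avgProj_K0_eq {ϖ : w.1.adicCompletion L}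
    (hϖ : Valued.v ϖ = WithZero.exp (-1 : ℤ))
    (g₁ : GL (Fin 3) (w.1.adicCompletion L)) (hg₁ : (g₁ : Matrix (Fin 3) (Fin 3) (w.1.adicCompletion L)) = Matrix.diagonal ![(1 : w.1.adicCompletion L), 1, ϖ])
    (K0 K1 I : Subgroup (Gqs L v))
    (hK0 : K0 = ((glInt 3 (w.1.adicCompletion L)).subgroupOf
      (unitaryGroupOfForm (galAdicCompletionMap (L := L) (IsCMField.complexConj L) hw) ((StdForm.antidiagonal 3).over (w.1.adicCompletion L)))).comap
        eA.toMulEquiv.toMonoidHom)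
    (hK1 : K1 = (((glInt 3 (w.1.adicCompletion L)).map (MulAut.conj g₁).toMonoidHom).subgroupOf
      (unitaryGroupOfForm (galAdicCompletionMap (L := L) (IsCMField.complexConj L) hw) ((StdForm.antidiagonal 3).over (w.1.adicCompletion L)))).comap
        eA.toMulEquiv.toMonoidHom)
    (hI : I = K0 ⊓ K1)
    (χ : ↥(torusU (conjLocal L (IsCMField.complexConj L) v) (cmLocalForm L 3 v)) →* ℂˣ)
    (hU : ∀ t : ↥(torusU (conjLocal L (IsCMField.complexConj L) v) (cmLocalForm L 3 v)),
      (t : ↥(unitaryGroupOfForm (conjLocal L (IsCMField.complexConj L) v) (cmLocalForm L 3 v))) ∈ cmLocalIntegralLevel L 3 (qsForm L) v → χ t = 1)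
    (R : Finset (Gqs L v)) (hR : IsLeftTransversal K0 (K0 ⊓ I) R) :
    haveI := locallyCompactSpace_cmBorelU L 3 v
    ∀ (f₁ f_w : Representation.SmoothInd (cmBorelTriple L 3 v).P
        (Representation.twist (((Representation.trivial ℂ ↥(torusU (conjLocal L (IsCMField.complexConj L) v) (cmLocalForm L 3 v)) ℂ).twist χ).comp
          (cmBorelTriple L 3 v).proj) (rootDeltaChar (cmBorelTriple L 3 v).P))),
      f₁ ∈ (cmPrincipalSeries L 3 v χ).fixedPoints I → f_w ∈ (cmPrincipalSeries L 3 v χ).fixedPoints I →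
      f₁.toFun 1 = 1 →
      f₁.toFun (eA.symm (weylLongU (galAdicCompletionMap (L := L) (IsCMField.complexConj L) hw) (rfl : (StdForm.antidiagonal 3).over (w.1.adicCompletion L) = _))) = 0 →
      f_w.toFun 1 = 0 →
      f_w.toFun (eA.symm (weylLongU (galAdicCompletionMap (L := L) (IsCMField.complexConj L) hw) (rfl : (StdForm.antidiagonal 3).over (w.1.adicCompletion L) = _))) = 1 →
      ∀ x y : ℂ, Representation.avgProj (G := Gqs L v) (cmPrincipalSeries L 3 v χ) K0 (x • f₁ + y • f_w) =
        ((R.card : ℂ)⁻¹ * (x + ((R.card : ℂ) - 1) * y)) • (f₁ + f_w) := by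
  classical
  intro f₁ f_w hf₁ hf_w h11 h1w hw1 hww x y
  have hlev := isOpen_isCompact_levels L v w hw eA g₁ K0 K1 I hK0 hK1 hI
  have hK0c : IsCompact (K0 : Set (Gqs L v)) := hlev.1.2
  have hIo : IsOpen (I : Set (Gqs L v)) := hlev.2.2.1
  -- `v = x f₁ + y f_w` is `I`-fixed, hence smooth, and `e_{K₀} v` is a finite average (★ `avgProj_eq`)
  have hv : x • f₁ + y • f_w ∈ (cmPrincipalSeries L 3 v χ).fixedPoints I := Submodule.add_mem _ (Submodule.smul_mem _ _ hf₁) (Submodule.smul_mem _ _ hf_w)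
  have hTv : ∀ t ∈ I, (cmPrincipalSeries L 3 v χ) t (x • f₁ + y • f_w) = x • f₁ + y • f_w := fun t ht => (Representation.mem_fixedPoints _ _ _).1 hv t ht
  have havg := Representation.avgProj_eq (G := Gqs L v) (ρ := cmPrincipalSeries L 3 v χ) hK0c hIo hTv hR
  have hsm : Representation.IsSmoothVector (G := Gqs L v) (cmPrincipalSeries L 3 v χ) (x • f₁ + y • f_w) :=
    F0P2pCmPrincipalSeriesInterface.isSmooth_cmPrincipalSeries L v χ _
  have hmem := Representation.avgProj_mem_fixedPoints (G := Gqs L v) (ρ := cmPrincipalSeries L 3 v χ) hK0c hsm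
  -- `e_{K₀} v ∈ V^{K₀} = ℂ(f₁ + f_w)` (★ II-1)
  have hline := K2E3PSIwahoriBasisPF.eq_smul_of_mem_fixedPoints_K0 L v w hw eA heA hϖ g₁ hg₁ K0 K1 I hK0 hK1 hI χ f₁ f_w _ hf₁ hf_w hmem h11 h1w hw1 hww
  -- values: `v(1) = x`, `v(w̃) = y`; `(r·v)(1) = v(r) = x` on `I`, `= y` on `K₀ ∖ I`
  have hv1 : (x • f₁ + y • f_w).toFun 1 = x := by
    simp [Representation.SmoothInd.toFun_add, Representation.SmoothInd.toFun_smul, h11, hw1]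
  have hvw : (x • f₁ + y • f_w).toFun (eA.symm (weylLongU (galAdicCompletionMap (L := L) (IsCMField.complexConj L) hw) (rfl : (StdForm.antidiagonal 3).over (w.1.adicCompletion L) = _))) = y := by
    simp [Representation.SmoothInd.toFun_add, Representation.SmoothInd.toFun_smul, h1w, hww]
  have hval : ∀ r ∈ R, ((cmPrincipalSeries L 3 v χ) r (x • f₁ + y • f_w)).toFun 1 = if r ∈ I then x else y := by
    intro r hr
    have e : ((cmPrincipalSeries L 3 v χ) r (x • f₁ + y • f_w)).toFun 1 = (x • f₁ + y • f_w).toFun r := by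
      have h := Representation.toFun_smoothIndRep_apply (show ↥(unitaryGroupOfForm (conjLocal L (IsCMField.complexConj L) v) (cmLocalForm L 3 v)) from r) (x • f₁ + y • f_w) 1
      rw [one_mul] at h
      exact h
    rw [e]
    by_cases hrI : r ∈ I
    · rw [if_pos hrI, toFun_apply_of_mem_I L v I χ _ hv r hrI, hv1]
    · rw [if_neg hrI, K2E3ParahoricAveragePF.toFun_apply_of_not_mem_I L v w hw eA heA hϖ g₁ hg₁ K0 K1 I hK0 hK1 hI χ (hU := hU) _ hv r (hR.mem_of_mem r hr) hrI, hvw]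
  -- the scalar `(e_{K₀} v)(1) = |R|⁻¹ Σ_r v(r) = |R|⁻¹ (x + (|R| − 1) y)`
  have hone : (R.filter fun r => r ∈ I).card = 1 := card_filter_mem_I_eq_one L v K0 I R hR
  have hR1 : 1 ≤ R.card := hone ▸ Finset.card_filter_le R (fun r => r ∈ I)
  have hrest : (R.filter fun r => ¬ r ∈ I).card = R.card - 1 := by
    have h := Finset.card_filter_add_card_filter_not (s := R) (fun r => r ∈ I)
    omega
  have hsum : ∑ r ∈ R, ((cmPrincipalSeries L 3 v χ) r (x • f₁ + y • f_w)).toFun 1 = x + ((R.card : ℂ) - 1) * y := by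
    rw [Finset.sum_congr rfl hval, Finset.sum_ite, Finset.sum_const, Finset.sum_const, hone, hrest, one_smul, nsmul_eq_mul,
      Nat.cast_sub hR1, Nat.cast_one]
  have hscal : (Representation.avgProj (G := Gqs L v) (cmPrincipalSeries L 3 v χ) K0 (x • f₁ + y • f_w)).toFun 1 =
      (R.card : ℂ)⁻¹ * (x + ((R.card : ℂ) - 1) * y) := by
    have h1 := congrArg (fun u => Representation.SmoothInd.toFun u 1) havg
    simp only [Representation.SmoothInd.toFun_smul, Pi.smul_apply, Representation.SmoothInd.toFun_sum, smul_eq_mul] at h1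
    -- the two spellings of the sum (`G_v` read as `Gqs L v` ∕ as the matrix carrier) agree term by term, definitionally
    refine h1.trans (Eq.trans ?_ (congrArg (fun z : ℂ => (R.card : ℂ)⁻¹ * z) hsum))
    exact congrArg (fun z : ℂ => (R.card : ℂ)⁻¹ * z) (Finset.sum_congr rfl fun r _ => rfl)
  exact hline.trans (congrArg (fun t : ℂ => t • (f₁ + f_w)) hscal)

include heA in
set_option maxHeartbeats 3200000 in
set_option synthInstance.maxHeartbeats 400000 in
-- instance-path unification between `Gqs L v` and the model group through `eA` (class of FILE C)
/-- **The cell test read through `eA`**: if `h·w̃·κ ∈ K₁` with `h ∈ B_v`, `κ ∈ I`, then `(d w̃)⁻¹ (h w̃ κ) ∈ I` for any Borel `d` with `d w̃ ∈ K₁` (§1 `inv_mul_mem_inf_of_mem_borelU` in the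
model, ★ FILE C `eA_mem_borelU_iff` ∕ `mem_comap_iff` ∕ `eA_vec`). [cite: BruhatTits1972, (4.4.3)] [cite: PlatonovRapinchuk1994, §5.1] -/
theorem inv_mul_mem_I_of_eq_borel_mul_weyl_mul {ϖ : w.1.adicCompletion L}
    (hϖ : Valued.v ϖ = WithZero.exp (-1 : ℤ))
    (g₁ : GL (Fin 3) (w.1.adicCompletion L)) (hg₁ : (g₁ : Matrix (Fin 3) (Fin 3) (w.1.adicCompletion L)) = Matrix.diagonal ![(1 : w.1.adicCompletion L), 1, ϖ])
    (K0 K1 I : Subgroup (Gqs L v))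
    (hK0 : K0 = ((glInt 3 (w.1.adicCompletion L)).subgroupOf
      (unitaryGroupOfForm (galAdicCompletionMap (L := L) (IsCMField.complexConj L) hw) ((StdForm.antidiagonal 3).over (w.1.adicCompletion L)))).comap
        eA.toMulEquiv.toMonoidHom)
    (hK1 : K1 = (((glInt 3 (w.1.adicCompletion L)).map (MulAut.conj g₁).toMonoidHom).subgroupOf
      (unitaryGroupOfForm (galAdicCompletionMap (L := L) (IsCMField.complexConj L) hw) ((StdForm.antidiagonal 3).over (w.1.adicCompletion L)))).comap
        eA.toMulEquiv.toMonoidHom)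
    (hI : I = K0 ⊓ K1)
    (d : ↥(cmBorelTriple L 3 v).P) (hdK1 : (d : ↥(unitaryGroupOfForm (conjLocal L (IsCMField.complexConj L) v) (cmLocalForm L 3 v))) * (![(1 : ↥(unitaryGroupOfForm (conjLocal L (IsCMField.complexConj L) v) (cmLocalForm L 3 v))), eA.symm (weylLongU (galAdicCompletionMap (L := L) (IsCMField.complexConj L) hw) (rfl : (StdForm.antidiagonal 3).over (w.1.adicCompletion L) = _))] 1) ∈ K1)
    (h : ↥(cmBorelTriple L 3 v).P) (κ : ↥(unitaryGroupOfForm (conjLocal L (IsCMField.complexConj L) v) (cmLocalForm L 3 v))) (hκ : κ ∈ I)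
    (hk : (h : ↥(unitaryGroupOfForm (conjLocal L (IsCMField.complexConj L) v) (cmLocalForm L 3 v))) * (![(1 : ↥(unitaryGroupOfForm (conjLocal L (IsCMField.complexConj L) v) (cmLocalForm L 3 v))), eA.symm (weylLongU (galAdicCompletionMap (L := L) (IsCMField.complexConj L) hw) (rfl : (StdForm.antidiagonal 3).over (w.1.adicCompletion L) = _))] 1) * κ ∈ K1) :
    ((d : ↥(unitaryGroupOfForm (conjLocal L (IsCMField.complexConj L) v) (cmLocalForm L 3 v))) * (![(1 : ↥(unitaryGroupOfForm (conjLocal L (IsCMField.complexConj L) v) (cmLocalForm L 3 v))), eA.symm (weylLongU (galAdicCompletionMap (L := L) (IsCMField.complexConj L) hw) (rfl : (StdForm.antidiagonal 3).over (w.1.adicCompletion L) = _))] 1))⁻¹ *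
      ((h : ↥(unitaryGroupOfForm (conjLocal L (IsCMField.complexConj L) v) (cmLocalForm L 3 v))) * (![(1 : ↥(unitaryGroupOfForm (conjLocal L (IsCMField.complexConj L) v) (cmLocalForm L 3 v))), eA.symm (weylLongU (galAdicCompletionMap (L := L) (IsCMField.complexConj L) hw) (rfl : (StdForm.antidiagonal 3).over (w.1.adicCompletion L) = _))] 1) * κ) ∈ I := by
  subst hI
  let eU : ↥(unitaryGroupOfForm (conjLocal L (IsCMField.complexConj L) v) (cmLocalForm L 3 v)) ≃ₜ* ↥(unitaryGroupOfForm (galAdicCompletionMap (L := L) (IsCMField.complexConj L) hw) ((StdForm.antidiagonal 3).over (w.1.adicCompletion L))) := eA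
  have hdB : eU (d : ↥(unitaryGroupOfForm (conjLocal L (IsCMField.complexConj L) v) (cmLocalForm L 3 v))) ∈ borelU (galAdicCompletionMap (L := L) (IsCMField.complexConj L) hw) ((StdForm.antidiagonal 3).over (w.1.adicCompletion L)) :=
    (eA_mem_borelU_iff L v w hw eA heA _).2 d.2
  have hhB : eU (h : ↥(unitaryGroupOfForm (conjLocal L (IsCMField.complexConj L) v) (cmLocalForm L 3 v))) ∈ borelU (galAdicCompletionMap (L := L) (IsCMField.complexConj L) hw) ((StdForm.antidiagonal 3).over (w.1.adicCompletion L)) :=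
    (eA_mem_borelU_iff L v w hw eA heA _).2 h.2
  have hw1 : eU (![(1 : ↥(unitaryGroupOfForm (conjLocal L (IsCMField.complexConj L) v) (cmLocalForm L 3 v))), eA.symm (weylLongU (galAdicCompletionMap (L := L) (IsCMField.complexConj L) hw) (rfl : (StdForm.antidiagonal 3).over (w.1.adicCompletion L) = _))] 1) =
      weylLongU (galAdicCompletionMap (L := L) (IsCMField.complexConj L) hw) (rfl : (StdForm.antidiagonal 3).over (w.1.adicCompletion L) = _) := by
    have e := eA_vec L v w hw eA 1
    simpa using e
  have htw : eU (d : ↥(unitaryGroupOfForm (conjLocal L (IsCMField.complexConj L) v) (cmLocalForm L 3 v))) * weylLongU (galAdicCompletionMap (L := L) (IsCMField.complexConj L) hw) (rfl : (StdForm.antidiagonal 3).over (w.1.adicCompletion L) = _) ∈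
      ((glInt 3 (w.1.adicCompletion L)).map (MulAut.conj g₁).toMonoidHom).subgroupOf _ := by
    rw [← hw1, ← map_mul]
    exact (mem_comap_iff L v w hw eA _ _).1 (hK1 ▸ hdK1)
  have hκ' : eU κ ∈ (glInt 3 (w.1.adicCompletion L)).subgroupOf _ ⊓ ((glInt 3 (w.1.adicCompletion L)).map (MulAut.conj g₁).toMonoidHom).subgroupOf _ :=
    Subgroup.mem_inf.2 ⟨(mem_comap_iff L v w hw eA _ _).1 (hK0 ▸ (Subgroup.mem_inf.1 hκ).1), (mem_comap_iff L v w hw eA _ _).1 (hK1 ▸ (Subgroup.mem_inf.1 hκ).2)⟩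
  have hk' : eU (h : ↥(unitaryGroupOfForm (conjLocal L (IsCMField.complexConj L) v) (cmLocalForm L 3 v))) * weylLongU (galAdicCompletionMap (L := L) (IsCMField.complexConj L) hw) (rfl : (StdForm.antidiagonal 3).over (w.1.adicCompletion L) = _) * eU κ ∈
      ((glInt 3 (w.1.adicCompletion L)).map (MulAut.conj g₁).toMonoidHom).subgroupOf _ := by
    rw [← hw1, ← map_mul, ← map_mul]
    exact (mem_comap_iff L v w hw eA _ _).1 (hK1 ▸ hk)
  have hmodel := inv_mul_mem_inf_of_mem_borelU (galAdicCompletionMap (L := L) (IsCMField.complexConj L) hw) rfl (fun a => valued_galAdicCompletionMap (L := L) (IsCMField.complexConj L) hw a) hϖ g₁ hg₁ hdB hhB htw hκ' hk'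
  -- pull back along `eA`
  have himg : eU (((d : ↥(unitaryGroupOfForm (conjLocal L (IsCMField.complexConj L) v) (cmLocalForm L 3 v))) * (![(1 : ↥(unitaryGroupOfForm (conjLocal L (IsCMField.complexConj L) v) (cmLocalForm L 3 v))), eA.symm (weylLongU (galAdicCompletionMap (L := L) (IsCMField.complexConj L) hw) (rfl : (StdForm.antidiagonal 3).over (w.1.adicCompletion L) = _))] 1))⁻¹ *
      ((h : ↥(unitaryGroupOfForm (conjLocal L (IsCMField.complexConj L) v) (cmLocalForm L 3 v))) * (![(1 : ↥(unitaryGroupOfForm (conjLocal L (IsCMField.complexConj L) v) (cmLocalForm L 3 v))), eA.symm (weylLongU (galAdicCompletionMap (L := L) (IsCMField.complexConj L) hw) (rfl : (StdForm.antidiagonal 3).over (w.1.adicCompletion L) = _))] 1) * κ)) =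
      (eU (d : ↥(unitaryGroupOfForm (conjLocal L (IsCMField.complexConj L) v) (cmLocalForm L 3 v))) * weylLongU (galAdicCompletionMap (L := L) (IsCMField.complexConj L) hw) (rfl : (StdForm.antidiagonal 3).over (w.1.adicCompletion L) = _))⁻¹ *
        (eU (h : ↥(unitaryGroupOfForm (conjLocal L (IsCMField.complexConj L) v) (cmLocalForm L 3 v))) * weylLongU (galAdicCompletionMap (L := L) (IsCMField.complexConj L) hw) (rfl : (StdForm.antidiagonal 3).over (w.1.adicCompletion L) = _) * eU κ) := by
    rw [map_mul, map_inv, map_mul, map_mul, map_mul, hw1]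
  refine Subgroup.mem_inf.2 ⟨?_, ?_⟩
  · rw [hK0]
    refine (mem_comap_iff L v w hw eA _ _).2 ?_
    change eU _ ∈ _
    rw [himg]
    exact (Subgroup.mem_inf.1 hmodel).1
  · rw [hK1]
    refine (mem_comap_iff L v w hw eA _ _).2 ?_
    change eU _ ∈ _
    rw [himg]
    exact (Subgroup.mem_inf.1 hmodel).2

include heA in
set_option maxHeartbeats 6400000 in
set_option synthInstance.maxHeartbeats 400000 in
-- instance-path unification between `Gqs L v` and the literal carrier of ★ `cmPrincipalSeries` (class of ★ II-2a §1)
/-- **Case (C): off the coset `(d w̃)·I` an `I`-fixed vector of an UNRAMIFIED `i_G(χ)` takes the value `f(1)` on `K₁`**: by Bruhat–Iwahori (★ FILE C `F0P3cStCharTSStLevelsPF.cover_borel_I`) `r = h·g·κ` with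
`h ∈ B_v`, `κ ∈ I`, `g ∈ {1, w̃}`; the cell `g = w̃` would put `r` in `(d w̃)·I` (the cell test); so `r = h κ` with `h = r κ⁻¹ ∈ B ∩ K₁`, where the inducing line is trivial
(★ PS-LEVELS `K2E3PSLevelsPF.inducingLine_eq_one_of_mem_K1`), and `f(r) = σ_χ(h) f(κ) = f(κ) = f(1)` (★ II-2a `toFun_apply_of_mem_I`). [cite: BruhatTits1972, (4.4.3)–(4.4.4)] [cite: Casselman1980, §3] -/
theorem toFun_apply_of_inv_mul_not_mem_I {ϖ : w.1.adicCompletion L}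
    (hϖ : Valued.v ϖ = WithZero.exp (-1 : ℤ))
    (g₁ : GL (Fin 3) (w.1.adicCompletion L)) (hg₁ : (g₁ : Matrix (Fin 3) (Fin 3) (w.1.adicCompletion L)) = Matrix.diagonal ![(1 : w.1.adicCompletion L), 1, ϖ])
    (K0 K1 I : Subgroup (Gqs L v))
    (hK0 : K0 = ((glInt 3 (w.1.adicCompletion L)).subgroupOf
      (unitaryGroupOfForm (galAdicCompletionMap (L := L) (IsCMField.complexConj L) hw) ((StdForm.antidiagonal 3).over (w.1.adicCompletion L)))).comap
        eA.toMulEquiv.toMonoidHom)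
    (hK1 : K1 = (((glInt 3 (w.1.adicCompletion L)).map (MulAut.conj g₁).toMonoidHom).subgroupOf
      (unitaryGroupOfForm (galAdicCompletionMap (L := L) (IsCMField.complexConj L) hw) ((StdForm.antidiagonal 3).over (w.1.adicCompletion L)))).comap
        eA.toMulEquiv.toMonoidHom)
    (hI : I = K0 ⊓ K1)
    (χ : ↥(torusU (conjLocal L (IsCMField.complexConj L) v) (cmLocalForm L 3 v)) →* ℂˣ)
    (hU : ∀ t : ↥(torusU (conjLocal L (IsCMField.complexConj L) v) (cmLocalForm L 3 v)),
      (t : ↥(unitaryGroupOfForm (conjLocal L (IsCMField.complexConj L) v) (cmLocalForm L 3 v))) ∈ cmLocalIntegralLevel L 3 (qsForm L) v → χ t = 1)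
    (d : ↥(cmBorelTriple L 3 v).P) (hdK1 : (d : ↥(unitaryGroupOfForm (conjLocal L (IsCMField.complexConj L) v) (cmLocalForm L 3 v))) * (![(1 : ↥(unitaryGroupOfForm (conjLocal L (IsCMField.complexConj L) v) (cmLocalForm L 3 v))), eA.symm (weylLongU (galAdicCompletionMap (L := L) (IsCMField.complexConj L) hw) (rfl : (StdForm.antidiagonal 3).over (w.1.adicCompletion L) = _))] 1) ∈ K1) :
    haveI := locallyCompactSpace_cmBorelU L 3 v
    ∀ (f : Representation.SmoothInd (cmBorelTriple L 3 v).P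
        (Representation.twist (((Representation.trivial ℂ ↥(torusU (conjLocal L (IsCMField.complexConj L) v) (cmLocalForm L 3 v)) ℂ).twist χ).comp
          (cmBorelTriple L 3 v).proj) (rootDeltaChar (cmBorelTriple L 3 v).P))), f ∈ (cmPrincipalSeries L 3 v χ).fixedPoints I →
      ∀ r : ↥(unitaryGroupOfForm (conjLocal L (IsCMField.complexConj L) v) (cmLocalForm L 3 v)), r ∈ K1 →
        ((d : ↥(unitaryGroupOfForm (conjLocal L (IsCMField.complexConj L) v) (cmLocalForm L 3 v))) * (![(1 : ↥(unitaryGroupOfForm (conjLocal L (IsCMField.complexConj L) v) (cmLocalForm L 3 v))), eA.symm (weylLongU (galAdicCompletionMap (L := L) (IsCMField.complexConj L) hw) (rfl : (StdForm.antidiagonal 3).over (w.1.adicCompletion L) = _))] 1))⁻¹ * r ∉ I →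
        f.toFun r = f.toFun 1 := by
  haveI := locallyCompactSpace_cmBorelU L 3 v
  intro f hf r hrK1 hrI
  obtain ⟨i, h, κ, hκ, hr⟩ := F0P3cStCharTSStLevelsPF.cover_borel_I L v w hw eA heA hϖ g₁ hg₁ K0 K1 I hK0 hK1 hI r
  fin_cases i
  · -- cell `1`: `r = h κ`, `h = r κ⁻¹ ∈ B ∩ K₁`
    simp only [Fin.zero_eta, Matrix.cons_val_zero, mul_one] at hr
    have hhK1 : (h : ↥(unitaryGroupOfForm (conjLocal L (IsCMField.complexConj L) v) (cmLocalForm L 3 v))) ∈ K1 := by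
      have e : (h : ↥(unitaryGroupOfForm (conjLocal L (IsCMField.complexConj L) v) (cmLocalForm L 3 v))) = r * κ⁻¹ := by rw [hr, mul_inv_cancel_right]
      rw [e]
      exact K1.mul_mem hrK1 (K1.inv_mem (I_le_K1 L v K0 K1 I hI hκ))
    have hline := K2E3PSLevelsPF.inducingLine_eq_one_of_mem_K1 L v w hw eA heA hϖ g₁ hg₁ K0 K1 I hK0 hK1 hI χ hU h hhK1
    rw [hr, Representation.SmoothInd.toFun_subgroup_mul f h, hline, Module.End.one_apply]
    exact toFun_apply_of_mem_I L v I χ f hf κ hκ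
  · -- cell `w̃`: excluded by the cell test
    simp only [Fin.mk_one] at hr
    exfalso
    apply hrI
    have hk : (h : ↥(unitaryGroupOfForm (conjLocal L (IsCMField.complexConj L) v) (cmLocalForm L 3 v))) * (![(1 : ↥(unitaryGroupOfForm (conjLocal L (IsCMField.complexConj L) v) (cmLocalForm L 3 v))), eA.symm (weylLongU (galAdicCompletionMap (L := L) (IsCMField.complexConj L) hw) (rfl : (StdForm.antidiagonal 3).over (w.1.adicCompletion L) = _))] 1) * κ ∈ K1 := by
      rw [← hr]; exact hrK1
    rw [hr]
    exact inv_mul_mem_I_of_eq_borel_mul_weyl_mul L v w hw eA heA hϖ g₁ hg₁ K0 K1 I hK0 hK1 hI d hdK1 h κ hκ hk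

/-! ## §3 A left transversal of `K₁ ∕ I` meets the coset `(d w̃)·I` exactly once -/

/-! ## §4 The `K₁`-average on the Iwahori plane -/

include heA in
set_option maxHeartbeats 12000000 in
set_option synthInstance.maxHeartbeats 400000 in
-- statement∕proof-heavy: the `SmoothInd` carrier of `cmPrincipalSeries`, averaging and II-1 (class of ★ II-2a §3)
/-- **`e_{K₁}(x f₁ + y f_w) = |R′|⁻¹ ((|R′| − 1) x + μ y) · (f₁ + μ⁻¹ f_w)`**, `μ = χ(proj d)·δ_B^{1∕2}(d)`, for the Iwahori pair `(f₁, f_w)` of an unramified `i_G(χ)`, any Borel `d`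
with `d w̃ ∈ K₁` and any left transversal `R′` of `K₁ ∕ I` (`|R′| = [K₁ : I]`): ★ `avgProj_eq` + §2 (values `μ y` on the coset `(d w̃)·I`, `x` elsewhere on `K₁`) + §3 + ★ II-1
`K2E3PSIwahoriBasisPF.eq_smul_of_mem_fixedPoints_K1` (`e_{K₁} v ∈ V^{K₁} = ℂ(f₁ + μ⁻¹ f_w)`).  This is the `K₁`-datum `(a₁ : b₁) = ([K₁:I] − 1 : μ)`, `e₁ = f₁ + μ⁻¹ f_w`, `c = μ⁻¹` of ★
`criterion_of_iwahoriLine`. [cite: Casselman1980, §3] [cite: BernsteinZelevinsky1976, §2.3] [cite: BruhatTits1972, (4.4.3)] -/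
theorem avgProj_K1_eq {ϖ : w.1.adicCompletion L}
    (hϖ : Valued.v ϖ = WithZero.exp (-1 : ℤ))
    (g₁ : GL (Fin 3) (w.1.adicCompletion L)) (hg₁ : (g₁ : Matrix (Fin 3) (Fin 3) (w.1.adicCompletion L)) = Matrix.diagonal ![(1 : w.1.adicCompletion L), 1, ϖ])
    (K0 K1 I : Subgroup (Gqs L v))
    (hK0 : K0 = ((glInt 3 (w.1.adicCompletion L)).subgroupOf
      (unitaryGroupOfForm (galAdicCompletionMap (L := L) (IsCMField.complexConj L) hw) ((StdForm.antidiagonal 3).over (w.1.adicCompletion L)))).comap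
        eA.toMulEquiv.toMonoidHom)
    (hK1 : K1 = (((glInt 3 (w.1.adicCompletion L)).map (MulAut.conj g₁).toMonoidHom).subgroupOf
      (unitaryGroupOfForm (galAdicCompletionMap (L := L) (IsCMField.complexConj L) hw) ((StdForm.antidiagonal 3).over (w.1.adicCompletion L)))).comap
        eA.toMulEquiv.toMonoidHom)
    (hI : I = K0 ⊓ K1)
    (χ : ↥(torusU (conjLocal L (IsCMField.complexConj L) v) (cmLocalForm L 3 v)) →* ℂˣ)
    (hU : ∀ t : ↥(torusU (conjLocal L (IsCMField.complexConj L) v) (cmLocalForm L 3 v)),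
      (t : ↥(unitaryGroupOfForm (conjLocal L (IsCMField.complexConj L) v) (cmLocalForm L 3 v))) ∈ cmLocalIntegralLevel L 3 (qsForm L) v → χ t = 1)
    (d : ↥(cmBorelTriple L 3 v).P) (hdK1 : (d : ↥(unitaryGroupOfForm (conjLocal L (IsCMField.complexConj L) v) (cmLocalForm L 3 v))) * (![(1 : ↥(unitaryGroupOfForm (conjLocal L (IsCMField.complexConj L) v) (cmLocalForm L 3 v))), eA.symm (weylLongU (galAdicCompletionMap (L := L) (IsCMField.complexConj L) hw) (rfl : (StdForm.antidiagonal 3).over (w.1.adicCompletion L) = _))] 1) ∈ K1)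
    (R : Finset (Gqs L v)) (hR : IsLeftTransversal K1 (K1 ⊓ I) R) :
    haveI := locallyCompactSpace_cmBorelU L 3 v
    ∀ (f₁ f_w : Representation.SmoothInd (cmBorelTriple L 3 v).P
        (Representation.twist (((Representation.trivial ℂ ↥(torusU (conjLocal L (IsCMField.complexConj L) v) (cmLocalForm L 3 v)) ℂ).twist χ).comp
          (cmBorelTriple L 3 v).proj) (rootDeltaChar (cmBorelTriple L 3 v).P))),
      f₁ ∈ (cmPrincipalSeries L 3 v χ).fixedPoints I → f_w ∈ (cmPrincipalSeries L 3 v χ).fixedPoints I →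
      f₁.toFun 1 = 1 →
      f₁.toFun (eA.symm (weylLongU (galAdicCompletionMap (L := L) (IsCMField.complexConj L) hw) (rfl : (StdForm.antidiagonal 3).over (w.1.adicCompletion L) = _))) = 0 →
      f_w.toFun 1 = 0 →
      f_w.toFun (eA.symm (weylLongU (galAdicCompletionMap (L := L) (IsCMField.complexConj L) hw) (rfl : (StdForm.antidiagonal 3).over (w.1.adicCompletion L) = _))) = 1 →
      ∀ x y : ℂ, Representation.avgProj (G := Gqs L v) (cmPrincipalSeries L 3 v χ) K1 (x • f₁ + y • f_w) =
        ((R.card : ℂ)⁻¹ * (((R.card : ℂ) - 1) * x + (((χ ((cmBorelTriple L 3 v).proj d) : ℂˣ) : ℂ) * ((rootDeltaChar (cmBorelTriple L 3 v).P d : ℂˣ) : ℂ)) * y)) •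
          (f₁ + (((χ ((cmBorelTriple L 3 v).proj d) : ℂˣ) : ℂ) * ((rootDeltaChar (cmBorelTriple L 3 v).P d : ℂˣ) : ℂ))⁻¹ • f_w) := by
  classical
  haveI := locallyCompactSpace_cmBorelU L 3 v
  intro f₁ f_w hf₁ hf_w h11 h1w hw1 hww x y
  obtain ⟨g, hgdef⟩ : ∃ g : Gqs L v, g = (d : ↥(unitaryGroupOfForm (conjLocal L (IsCMField.complexConj L) v) (cmLocalForm L 3 v))) * (![(1 : ↥(unitaryGroupOfForm (conjLocal L (IsCMField.complexConj L) v) (cmLocalForm L 3 v))), eA.symm (weylLongU (galAdicCompletionMap (L := L) (IsCMField.complexConj L) hw) (rfl : (StdForm.antidiagonal 3).over (w.1.adicCompletion L) = _))] 1) := ⟨_, rfl⟩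
  have hgK1 : g ∈ K1 := hgdef ▸ hdK1
  have hlev := isOpen_isCompact_levels L v w hw eA g₁ K0 K1 I hK0 hK1 hI
  have hK1c : IsCompact (K1 : Set (Gqs L v)) := hlev.2.1.2
  have hIo : IsOpen (I : Set (Gqs L v)) := hlev.2.2.1
  -- `v = x f₁ + y f_w` is `I`-fixed, hence smooth, and `e_{K₁} v` is a finite average (★ `avgProj_eq`)
  have hv : x • f₁ + y • f_w ∈ (cmPrincipalSeries L 3 v χ).fixedPoints I := Submodule.add_mem _ (Submodule.smul_mem _ _ hf₁) (Submodule.smul_mem _ _ hf_w)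
  have hTv : ∀ t ∈ I, (cmPrincipalSeries L 3 v χ) t (x • f₁ + y • f_w) = x • f₁ + y • f_w := fun t ht => (Representation.mem_fixedPoints _ _ _).1 hv t ht
  have havg := Representation.avgProj_eq (G := Gqs L v) (ρ := cmPrincipalSeries L 3 v χ) hK1c hIo hTv hR
  have hsm : Representation.IsSmoothVector (G := Gqs L v) (cmPrincipalSeries L 3 v χ) (x • f₁ + y • f_w) :=
    F0P2pCmPrincipalSeriesInterface.isSmooth_cmPrincipalSeries L v χ _
  have hmem := Representation.avgProj_mem_fixedPoints (G := Gqs L v) (ρ := cmPrincipalSeries L 3 v χ) hK1c hsm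
  -- `e_{K₁} v ∈ V^{K₁} = ℂ(f₁ + μ⁻¹ f_w)` (★ II-1)
  have hline := K2E3PSIwahoriBasisPF.eq_smul_of_mem_fixedPoints_K1 L v w hw eA heA hϖ g₁ hg₁ K0 K1 I hK0 hK1 hI χ d hdK1 f₁ f_w _ hf₁ hf_w hmem h11 h1w hw1 hww
  -- values: `v(1) = x`, `v(w̃) = y`; `(r·v)(1) = v(r) = μ y` on `(d w̃)·I`, `= x` elsewhere on `K₁`
  have hv1 : (x • f₁ + y • f_w).toFun 1 = x := by
    simp [Representation.SmoothInd.toFun_add, Representation.SmoothInd.toFun_smul, h11, hw1]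
  have hvw : (x • f₁ + y • f_w).toFun (eA.symm (weylLongU (galAdicCompletionMap (L := L) (IsCMField.complexConj L) hw) (rfl : (StdForm.antidiagonal 3).over (w.1.adicCompletion L) = _))) = y := by
    simp [Representation.SmoothInd.toFun_add, Representation.SmoothInd.toFun_smul, h1w, hww]
  have hval : ∀ r ∈ R, ((cmPrincipalSeries L 3 v χ) r (x • f₁ + y • f_w)).toFun 1 =
      if g⁻¹ * r ∈ I then
        (((χ ((cmBorelTriple L 3 v).proj d) : ℂˣ) : ℂ) * ((rootDeltaChar (cmBorelTriple L 3 v).P d : ℂˣ) : ℂ)) * y else x := by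
    intro r hr
    have e : ((cmPrincipalSeries L 3 v χ) r (x • f₁ + y • f_w)).toFun 1 = (x • f₁ + y • f_w).toFun r := by
      have h := Representation.toFun_smoothIndRep_apply (show ↥(unitaryGroupOfForm (conjLocal L (IsCMField.complexConj L) v) (cmLocalForm L 3 v)) from r) (x • f₁ + y • f_w) 1
      rw [one_mul] at h
      exact h
    rw [e]
    by_cases hrI : g⁻¹ * r ∈ I
    · rw [if_pos hrI, toFun_apply_of_inv_mul_mem_I L v w hw eA I χ d _ hv r (hgdef ▸ hrI), hvw]
    · rw [if_neg hrI, toFun_apply_of_inv_mul_not_mem_I L v w hw eA heA hϖ g₁ hg₁ K0 K1 I hK0 hK1 hI χ hU d hdK1 _ hv r (hR.mem_of_mem r hr) (hgdef ▸ hrI), hv1]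
  -- the scalar `(e_{K₁} v)(1) = |R|⁻¹ Σ_r v(r) = |R|⁻¹ ((|R| − 1) x + μ y)`
  have hone : (R.filter fun r => g⁻¹ * r ∈ I).card = 1 :=
    card_filter_inv_mul_mem_I_eq_one L v K1 I R hR g hgK1
  have hR1 : 1 ≤ R.card := hone ▸ Finset.card_filter_le R _
  have hrest : (R.filter fun r => ¬ g⁻¹ * r ∈ I).card = R.card - 1 := by
    have h := Finset.card_filter_add_card_filter_not (s := R) (fun r => g⁻¹ * r ∈ I)
    omega
  have hsum : ∑ r ∈ R, ((cmPrincipalSeries L 3 v χ) r (x • f₁ + y • f_w)).toFun 1 =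
      ((R.card : ℂ) - 1) * x + (((χ ((cmBorelTriple L 3 v).proj d) : ℂˣ) : ℂ) * ((rootDeltaChar (cmBorelTriple L 3 v).P d : ℂˣ) : ℂ)) * y := by
    rw [Finset.sum_congr rfl hval, Finset.sum_ite, Finset.sum_const, Finset.sum_const, hone, hrest, one_smul, nsmul_eq_mul,
      Nat.cast_sub hR1, Nat.cast_one]
    ring
  have hscal : (Representation.avgProj (G := Gqs L v) (cmPrincipalSeries L 3 v χ) K1 (x • f₁ + y • f_w)).toFun 1 =
      (R.card : ℂ)⁻¹ * (((R.card : ℂ) - 1) * x + (((χ ((cmBorelTriple L 3 v).proj d) : ℂˣ) : ℂ) * ((rootDeltaChar (cmBorelTriple L 3 v).P d : ℂˣ) : ℂ)) * y) := by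
    have h1 := congrArg (fun u => Representation.SmoothInd.toFun u 1) havg
    simp only [Representation.SmoothInd.toFun_smul, Pi.smul_apply, Representation.SmoothInd.toFun_sum, smul_eq_mul] at h1
    -- the two spellings of the sum (`G_v` read as `Gqs L v` ∕ as the matrix carrier) agree term by term, definitionally
    refine h1.trans (Eq.trans ?_ (congrArg (fun z : ℂ => (R.card : ℂ)⁻¹ * z) hsum))
    exact congrArg (fun z : ℂ => (R.card : ℂ)⁻¹ * z) (Finset.sum_congr rfl fun r _ => rfl)
  exact hline.trans (congrArg (fun t : ℂ => t • (f₁ + (((χ ((cmBorelTriple L 3 v).proj d) : ℂˣ) : ℂ) * ((rootDeltaChar (cmBorelTriple L 3 v).P d : ℂˣ) : ℂ))⁻¹ • f_w)) hscal)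

end Summit.HodgeConjecture.HodgeConjecture.Cruxes.H413.K2E3ParahoricAveragePF

end
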